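import Summits.HodgeConjecture.HodgeCM.Model.ToyG2.ThetaGram_3

/-! PORT of `HodgeCM/Model/ToyG2/ThetaGram.lean` (HodgeCMPerL run 82) — part 4: continuation of `Summits.HodgeConjecture.HodgeCM.Model.ToyG2.ThetaGram_3` (split at a top-level declaration boundary by port_pkg.py; scope re-opened below; declarations unchanged). -/

-- port_pkg: scope re-opened for this part (file-level context, then the namespace/section stack open at the cut)
open scoped TensorProduct InnerProductSpace
open HodgeCM.Toy HodgeCM.Toy.CMPresentation exteriorPower NumberField.ComplexEmbedding
open Literature.AlgebraicGeometry.Motives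
namespace HodgeCM.ToyG2.ThetaUiso
noncomputable section
open scoped Classical
section Assembly
variable (d t : ℚ) {L : CMField} (ι₁ : L →+* ℂ) {V : HermSpace3 L ι₁} (Γ : Level V)
variable (hd : (1 : ℚ) ≤ d) (ht : t ^ 2 = 16)
/-- **`inner_Λ` FOR THE PERIOD LEAF OF `toyUniverse₃ d t`** (the field `ThetaRealisation.inner_Λ` at level `Γ`,
with the constant `c = ¼`): for every quadruple of `(1,0)`-classes,
`⟪Λ(ω₂, ω₃), Λ(ω₀, ω₁)⟫ = ¼ · ∫ ω₀ ∧ ω₁ ∧ ω̄₂ ∧ ω̄₃`. -/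
theorem inner_Λ₃ (ω : Fin 4 → (toyUniverse₃ d t).CohC ((toyUniverse₃ d t).pms L ι₁ V Γ) 1)
    (hω : ∀ i, ω i ∈ (toyUniverse₃ d t).H10 ((toyUniverse₃ d t).pms L ι₁ V Γ)) :
    ⟪Λ ι₁ d t hd ht (ω 2) (ω 3), Λ ι₁ d t hd ht (ω 0) (ω 1)⟫_ℂ
      = (1 / 4 : ℂ) * (toyUniverse₃ d t).period ((toyUniverse₃ d t).pms L ι₁ V Γ) ω := by
  have hmem : ∀ i, ω i ∈ Submodule.span ℂ (holSet d t ι₁) := by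
    intro i
    have h := hω i
    rw [H10_eq_span₃ d t ι₁ Γ] at h
    exact h
  rw [Universe.period_eq_period4]
  exact inner_Λ_span d t ι₁ Γ hd ht _ (hmem 0) _ (hmem 1) _ (hmem 2) _ (hmem 3)

end Assembly

/-! ### §6 The theta vectors: the kernel relation and non-vanishing

For an embedding `θ` holomorphic for all four types of block `q` (toy-g2's `P 0 θ`), the pair `(E_{q,0,θ}, E_{q,1,θ})`
has shape `sec 0 θ` and `(E_{q,2,θ}, E_{q,3,θ})` has shape `fst 0 θ`; toy-g2's singular `2 × 2` block gives the
KERNEL RELATION and the non-vanishing below (the inputs of `lineField`, `gen12`, `real34` in R3-b). -/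
section ThetaVectors

variable {L : CMField} (ι₁ : L →+* ℂ) (d t : ℚ) (q : Fin (nQ L ι₁)) (hd : (1 : ℚ) ≤ d) (ht : t ^ 2 = 16)

/-- (Ported verbatim from the HodgeCMPerL package; no docstring in the source.) -/
theorem mkW_01 (θ : FK L →+* ℂ) : mkW (0 : Fin 4) 1 θ θ = (blockData ι₁ d t hd ht q).sec 0 θ := by
  simp [mkW, shapeOf, BlockData.sec, BlockData.τ]

/-- (Ported verbatim from the HodgeCMPerL package; no docstring in the source.) -/
theorem mkW_23 (θ : FK L →+* ℂ) : mkW (2 : Fin 4) 3 θ θ = (blockData ι₁ d t hd ht q).fst 0 θ := by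
  simp [mkW, shapeOf, BlockData.fst, BlockData.τ]

/-- an embedding holomorphic for all four types of block `q` satisfies toy-g2's `P 0` -/
theorem P_zero_of_hol {θ : FK L →+* ℂ}
    (h0 : θ.comp (eK L : L →+* FK L) ∈ (ΘOf L ι₁ q 0).1) (h1 : θ.comp (eK L : L →+* FK L) ∈ (ΘOf L ι₁ q 1).1)
    (h2 : θ.comp (eK L : L →+* FK L) ∈ (ΘOf L ι₁ q 2).1) (h3 : θ.comp (eK L : L →+* FK L) ∈ (ΘOf L ι₁ q 3).1) :
    (blockData ι₁ d t hd ht q).P 0 θ := by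
  refine ⟨?_, ?_⟩
  · rw [← mkW_23 ι₁ d t q hd ht θ]
    exact valid_mkW ι₁ d t q hd ht (show (2 : Fin 4) < 3 by decide) h2 h3
  · rw [← mkW_01 ι₁ d t q hd ht θ]
    exact valid_mkW ι₁ d t q hd ht (show (0 : Fin 4) < 1 by decide) h0 h1

/-- toy-g2's kernel relation `g (sec 0 θ) = (β₀/α₀) • g (fst 0 θ)`, transported to the Gram vectors of block `q` -/
theorem Gv_sec_zero {θ : FK L →+* ℂ} (hP : (blockData ι₁ d t hd ht q).P 0 θ) :
    Gv ι₁ d t hd ht q ((blockData ι₁ d t hd ht q).sec 0 θ)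
      = ((((blockData ι₁ d t hd ht q).β 0 θ / (blockData ι₁ d t hd ht q).α 0 θ : ℝ)) : ℂ)
          • Gv ι₁ d t hd ht q ((blockData ι₁ d t hd ht q).fst 0 θ) := by
  refine PiLp.ext (fun p => ?_)
  rw [PiLp.smul_apply, Gv_apply, Gv_apply, BlockData.g_sec_zero_eq_smul _ hP, Pi.smul_apply, smul_eq_mul,
    smul_eq_mul, Complex.ofReal_mul, mul_ite, mul_zero]

/-- **KERNEL RELATION** on the theta vectors of block `q`:
`Λ(E_{q,0,θ}, E_{q,1,θ}) = (β₀(θ)/α₀(θ)) • Λ(E_{q,2,θ}, E_{q,3,θ})`. -/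
theorem Λ_theta01_eq_smul {θ : FK L →+* ℂ}
    (h0 : θ.comp (eK L : L →+* FK L) ∈ (ΘOf L ι₁ q 0).1) (h1 : θ.comp (eK L : L →+* FK L) ∈ (ΘOf L ι₁ q 1).1)
    (h2 : θ.comp (eK L : L →+* FK L) ∈ (ΘOf L ι₁ q 2).1) (h3 : θ.comp (eK L : L →+* FK L) ∈ (ΘOf L ι₁ q 3).1) :
    Λ ι₁ d t hd ht (eCls ι₁ d t q 0 θ) (eCls ι₁ d t q 1 θ)
      = ((((blockData ι₁ d t hd ht q).β 0 θ / (blockData ι₁ d t hd ht q).α 0 θ : ℝ)) : ℂ)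
          • Λ ι₁ d t hd ht (eCls ι₁ d t q 2 θ) (eCls ι₁ d t q 3 θ) := by
  rw [Λ_eCls_lt ι₁ d t q hd ht (show (0 : Fin 4) < 1 by decide) h0 h1,
    Λ_eCls_lt ι₁ d t q hd ht (show (2 : Fin 4) < 3 by decide) h2 h3, mkW_01 ι₁ d t q hd ht,
    mkW_23 ι₁ d t q hd ht, Gv_sec_zero ι₁ d t q hd ht (P_zero_of_hol ι₁ d t q hd ht h0 h1 h2 h3)]

/-- **NON-VANISHING** of the theta vector `Λ(E_{q,2,θ}, E_{q,3,θ})` of block `q`. -/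
theorem Λ_theta23_ne_zero {θ : FK L →+* ℂ}
    (h0 : θ.comp (eK L : L →+* FK L) ∈ (ΘOf L ι₁ q 0).1) (h1 : θ.comp (eK L : L →+* FK L) ∈ (ΘOf L ι₁ q 1).1)
    (h2 : θ.comp (eK L : L →+* FK L) ∈ (ΘOf L ι₁ q 2).1) (h3 : θ.comp (eK L : L →+* FK L) ∈ (ΘOf L ι₁ q 3).1) :
    Λ ι₁ d t hd ht (eCls ι₁ d t q 2 θ) (eCls ι₁ d t q 3 θ) ≠ 0 := by
  rw [Λ_eCls_lt ι₁ d t q hd ht (show (2 : Fin 4) < 3 by decide) h2 h3, mkW_23 ι₁ d t q hd ht]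
  intro h
  apply (blockData ι₁ d t hd ht q).g_fst_ne_zero (P_zero_of_hol ι₁ d t q hd ht h0 h1 h2 h3)
  funext x
  have hx := congrArg (fun v : HG L ι₁ => v (q, x)) h
  simpa [Gv_apply] using hx

end ThetaVectors

end

end HodgeCM.ToyG2.ThetaUiso
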